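import Summits.CriticalPhenomena.PercolationContinuityZ3.Theorems.PercNearOneGluingAdditiveGluingTwoStepGlueTools
import HarnessLib

/-!
# Crux `PercNearOneGluing.AdditiveGluing` (stmt-CriticalPhenomena-4576): the TWO-STEP GLUING reduction of the three-relay
# case — CAG(3) from ONE five-point inequality

Support file (`--supports stmt-CriticalPhenomena-4576`; task png-dp-al5, memo `TWOSTEP-GLUE.md` on the item).  No definitions,
no named facts, no sorries.  Notation: weighted complete graph on `Fin n`, `μ = μ_w = prodBernoulli w`, target `b`, observer `o`,
relays `a₁, a₂` (the pair `e = s(a₁,a₂)` to be glued) and `c` (the third relay), `τ_x = μ(x ↔ b)`, `θ` a common lower bound of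
`τ_{a₁}, τ_{a₂}` (in the crux: `θ = min_A τ = 1 − t`).  Events: `O_x = {o ↔ x}`, `B_x = {x ↔ b}`, `oA = O_{a₁} ∪ O_{a₂} ∪ O_c`,
`Ab = B_{a₁} ∪ B_{a₂} ∪ B_c`, `B₁₂ = B_{a₁} ∪ B_{a₂}`, `O₁₂ = O_{a₁} ∪ O_{a₂}`, `N = {c ↮ a₁} ∩ {c ↮ a₂}`.

**CAG(3)** (the conditioned additive-gluing inequality, `…CAG.lean`: `μ(oA ∩ (o↔b)ᶜ ∩ Ab) ≤ μ(Ab) − θ`) implies the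
three-relay E-form `μ(oA ∖ o↔b) ≤ 1 − θ` and hence the three-relay instances of the crux.  The tools (weighted
Kozma–Nitzan Theorem 1, pull-backs along the glued pair) are in `…AdditiveGluingTwoStepGlueTools.lean`:

* `twoStep_thm1_weighted` (tools file) — Kozma–Nitzan's Theorem 1 in its WEIGHTED form (6) (p. 7), for relays `x, y` and every weighting:
  `μ(D ∩ O_x)·[μ(E) − μ(F_x)] + μ(D ∩ O_y)·[μ(E) − μ(F_y)] ≥ 0`, `D = {x ↮ y}`, `E = {o↔b} ∩ (O_x ∪ O_y)`, `F_x = (O_x ∪ O_y) ∩ B_x`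
  ("BHK four times", exactly as in the landed `KNPreFKG.preFKG_pair`, keeping the weights instead of taking the minimum);
This file proves

* `twoStep_cag3` — **the reduction**: CAG(3) for `{a₁, a₂, c}` follows from the single inequality
  `(ψ₁₂ + ψ_c)·(G_o + θ) ≤ ψ₁₂·(μ(B₁₂) + ROOM₂) + ψ_c·(τ_c + G_c + ROOM₁)`            (★★)
  where `ψ₁₂ = μ(N ∩ O₁₂)`, `ψ_c = μ(N ∩ O_c)` (Kozma–Nitzan's `φ({1,2})·μ(N)`, `φ({3})·μ(N)`),
  `G_x = μ((x↔b)ᶜ ∩ (x↔a₁ ∪ x↔a₂) ∩ B₁₂)` = the probability that the pair is pivotal for `x ↔ b` (= `τ_x(w[e↦1]) − τ_x(w)`),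
  `ROOM₁ = μ(oAᶜ ∩ B₁₂ ∩ B_cᶜ ∩ N)`, `ROOM₂ = μ(oAᶜ ∩ B_c ∩ B₁₂ᶜ)`.
  Proof: glue `e` (`w¹ = w[e ↦ 1]`, pushforward `ω ↦ ω ∪ {e}`: `fullTie_real_update_one`, `fullTie_glueReach_pair`);
  `μ(oA ∩ (o↔b)ᶜ ∩ Ab) = G_o + Gain¹(o)` with `Gain¹(o)` the gain of `o` from gluing the remaining pair `{a₁, c}` in `w¹`;
  `twoStep_thm1_weighted` in `w¹` with relays `a₁` (the glued class) and `c` bounds `(ψ₁₂+ψ_c)·Gain¹(o) ≤ ψ₁₂·T_c + ψ_c·T_{a₁}`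
  with `T_c = μ(Ab) − μ(B₁₂) − ROOM₂`, `T_{a₁} = μ(Ab) − τ_c − G_c − ROOM₁` (pull-backs to `w`); (★★) closes the algebra, and the
  degenerate case `ψ₁₂ + ψ_c = 0` is Kozma–Nitzan's Lemma 4 (`knLemma4_pair`).
* `twoStep_cag3_of_v3prime` — (★★) from the hypothesis-free form
  `(V3′)  (ψ₁₂ + ψ_c)·G_o ≤ ψ₁₂·(μ(B₁₂) − min(τ_{a₁},τ_{a₂}) + ROOM₂) + ψ_c·(G_c + ROOM₁)`
  ("Kozma–Nitzan Lemma 4 with a weighted spectator"; numerically 0 violations in 16 500 random instances and under adversarial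
  search, task memo TWOSTEP-GLUE.md) and `θ ≤ τ_{a₁}, τ_{a₂}, τ_c`;
* `twoStep_threeRelays_eform` — the three-relay E-form `μ((o↔a₁ ∪ o↔a₂ ∪ o↔a₃) ∖ o↔b) ≤ t` from (★★) for one pair and
  `1 − t ≤ τ_{a₁}, τ_{a₂}, τ_{a₃}`.
[cite: KozmaNitzan2024, Theorem 1 and (6) (pp. 7–8), Lemma 4 / eq. (8)–(9) (pp. 9–10), Question 7 (p. 36)]
[cite: VandenbergHaggstromKahn2005, Thms. 1.3–1.4 (pp. 6–7)]
-/

namespace Summit.CriticalPhenomena.PercolationContinuityZ3.Theorems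

open MeasureTheory Set Literature.Probability.LatticeModels Literature.Probability.Percolation

noncomputable section
open Classical

variable {n : ℕ}

/-! ### The two-step gluing reduction -/

/-- **CAG(3) from (★★).**  Observer `o`, target `b`, relays `a₁ ≠ a₂` (the glued pair) and `c ≠ a₁`, a real `θ ≤ τ_{a₁}, τ_{a₂}`.
If
`(ψ₁₂ + ψ_c)·(G_o + θ) ≤ ψ₁₂·(μ(a₁↔b ∪ a₂↔b) + ROOM₂) + ψ_c·(τ_c + G_c + ROOM₁)`                                (★★)
(notation in the file header; every quantity is the probability of an explicit event below), then
`μ((o↔a₁ ∪ o↔a₂ ∪ o↔c) ∩ (o↔b)ᶜ ∩ (a₁↔b ∪ a₂↔b ∪ c↔b)) ≤ μ(a₁↔b ∪ a₂↔b ∪ c↔b) − θ`  (CAG for `A = {a₁,a₂,c}`).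
Proof: glue `{a₁,a₂}`; weighted Kozma–Nitzan Theorem 1 (`twoStep_thm1_weighted`) in the glued weighting; pull-backs
(`twoStep_glue_*`); Kozma–Nitzan Lemma 4 (`knLemma4_pair`) in the degenerate case `ψ₁₂ + ψ_c = 0`.
[cite: KozmaNitzan2024, Theorem 1 / (6) (pp. 7–8), Lemma 4 (p. 9), Question 7 (p. 36)] -/
theorem twoStep_cag3 (w : Sym2 (Fin n) → unitInterval) (o b a₁ a₂ c : Fin n) (h12 : a₁ ≠ a₂) (h1c : a₁ ≠ c) (θ : ℝ)
    (hθ1 : θ ≤ (prodBernoulli w).real (openConn a₁ b)) (hθ2 : θ ≤ (prodBernoulli w).real (openConn a₂ b))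
    (hstar :
      ((prodBernoulli w).real ((openConn c a₁)ᶜ ∩ (openConn c a₂)ᶜ ∩ (openConn o a₁ ∪ openConn o a₂)) +
          (prodBernoulli w).real ((openConn c a₁)ᶜ ∩ (openConn c a₂)ᶜ ∩ openConn o c)) *
        ((prodBernoulli w).real ((openConn o b)ᶜ ∩ (openConn o a₁ ∪ openConn o a₂) ∩ (openConn a₁ b ∪ openConn a₂ b)) + θ) ≤
      (prodBernoulli w).real ((openConn c a₁)ᶜ ∩ (openConn c a₂)ᶜ ∩ (openConn o a₁ ∪ openConn o a₂)) *
          ((prodBernoulli w).real (openConn a₁ b ∪ openConn a₂ b) +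
            (prodBernoulli w).real ((openConn o a₁ ∪ openConn o a₂ ∪ openConn o c)ᶜ ∩ openConn c b ∩
              (openConn a₁ b ∪ openConn a₂ b)ᶜ)) +
        (prodBernoulli w).real ((openConn c a₁)ᶜ ∩ (openConn c a₂)ᶜ ∩ openConn o c) *
          ((prodBernoulli w).real (openConn c b) +
            (prodBernoulli w).real ((openConn c b)ᶜ ∩ (openConn c a₁ ∪ openConn c a₂) ∩ (openConn a₁ b ∪ openConn a₂ b)) +
            (prodBernoulli w).real ((openConn o a₁ ∪ openConn o a₂ ∪ openConn o c)ᶜ ∩ (openConn a₁ b ∪ openConn a₂ b) ∩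
              (openConn c b)ᶜ ∩ ((openConn c a₁)ᶜ ∩ (openConn c a₂)ᶜ)))) :
    (prodBernoulli w).real ((openConn o a₁ ∪ openConn o a₂ ∪ openConn o c) ∩ (openConn o b)ᶜ ∩
        (openConn a₁ b ∪ openConn a₂ b ∪ openConn c b)) ≤
      (prodBernoulli w).real (openConn a₁ b ∪ openConn a₂ b ∪ openConn c b) - θ := by
  set μ := prodBernoulli w with hμ
  have hm : ∀ s : Set (BondConfig (Fin n)), MeasurableSet s := fun _ => MeasurableSet.of_discrete
  -- events in `w`
  set O₁ : Set (BondConfig (Fin n)) := openConn o a₁ with hO₁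
  set O₂ : Set (BondConfig (Fin n)) := openConn o a₂ with hO₂
  set Oc : Set (BondConfig (Fin n)) := openConn o c with hOc
  set Ob : Set (BondConfig (Fin n)) := openConn o b with hOb
  set B₁ : Set (BondConfig (Fin n)) := openConn a₁ b with hB₁
  set B₂ : Set (BondConfig (Fin n)) := openConn a₂ b with hB₂
  set Bc : Set (BondConfig (Fin n)) := openConn c b with hBc
  set C₁ : Set (BondConfig (Fin n)) := openConn c a₁ with hC₁
  set C₂ : Set (BondConfig (Fin n)) := openConn c a₂ with hC₂
  -- Step 1: weighted Theorem 1 in the glued weighting, pulled back to `w`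
  have hT := twoStep_thm1_weighted (Function.update w s(a₁, a₂) 1) o b a₁ c h1c
  rw [twoStep_EF_identity (Function.update w s(a₁, a₂) 1) o b a₁ c] at hT
  have hEF2 := twoStep_EF_identity (Function.update w s(a₁, a₂) 1) o b c a₁
  have hu1 : (openConn o c ∪ openConn o a₁ : Set (BondConfig (Fin n))) = openConn o a₁ ∪ openConn o c :=
    Set.union_comm _ _
  have hu2 : (openConn c b ∪ openConn a₁ b : Set (BondConfig (Fin n))) = openConn a₁ b ∪ openConn c b :=
    Set.union_comm _ _
  rw [hu1, hu2] at hEF2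
  rw [hEF2, twoStep_glue_psi12 w h12 o c, twoStep_glue_psic w h12 o c, twoStep_glue_gain w h12 o b c,
    twoStep_glue_Tc w h12 o b c, twoStep_glue_Ta w h12 o b c] at hT
  simp only [← hμ, ← hO₁, ← hO₂, ← hOc, ← hOb, ← hB₁, ← hB₂, ← hBc, ← hC₁, ← hC₂] at hT hstar ⊢
  -- Step 2: identities in `w`
  -- (d1) `μ(oA ∩ Obᶜ ∩ Ab) = G_o + μ(GG)`
  have hd1 : μ.real ((O₁ ∪ O₂ ∪ Oc) ∩ Obᶜ ∩ (B₁ ∪ B₂ ∪ Bc)) =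
      μ.real (Obᶜ ∩ (O₁ ∪ O₂) ∩ (B₁ ∪ B₂)) +
        μ.real ((O₁ ∪ O₂ ∪ Oc) ∩ Obᶜ ∩ ((O₁ ∪ O₂) ∩ (B₁ ∪ B₂))ᶜ ∩ (B₁ ∪ B₂ ∪ Bc)) := by
    have h := measureReal_inter_add_sdiff (μ := μ) (s := (O₁ ∪ O₂ ∪ Oc) ∩ Obᶜ ∩ (B₁ ∪ B₂ ∪ Bc))
      (hm ((O₁ ∪ O₂) ∩ (B₁ ∪ B₂)))
    have e1 : (O₁ ∪ O₂ ∪ Oc) ∩ Obᶜ ∩ (B₁ ∪ B₂ ∪ Bc) ∩ ((O₁ ∪ O₂) ∩ (B₁ ∪ B₂)) =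
        Obᶜ ∩ (O₁ ∪ O₂) ∩ (B₁ ∪ B₂) := by
      ext ω
      simp only [Set.mem_inter_iff, Set.mem_union, Set.mem_compl_iff]
      tauto
    have e2 : ((O₁ ∪ O₂ ∪ Oc) ∩ Obᶜ ∩ (B₁ ∪ B₂ ∪ Bc)) \ ((O₁ ∪ O₂) ∩ (B₁ ∪ B₂)) =
        (O₁ ∪ O₂ ∪ Oc) ∩ Obᶜ ∩ ((O₁ ∪ O₂) ∩ (B₁ ∪ B₂))ᶜ ∩ (B₁ ∪ B₂ ∪ Bc) := by
      ext ω
      simp only [Set.mem_sdiff, Set.mem_inter_iff, Set.mem_compl_iff]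
      tauto
    rw [e1, e2] at h
    linarith
  -- (d2) `μ(TcW) = μ(Ab) − μ(B12) − ROOM₂`
  have hd2 : μ.real ((O₁ ∪ O₂ ∪ Oc) ∩ Bc ∩ (B₁ ∪ B₂)ᶜ) =
      μ.real (B₁ ∪ B₂ ∪ Bc) - μ.real (B₁ ∪ B₂) - μ.real ((O₁ ∪ O₂ ∪ Oc)ᶜ ∩ Bc ∩ (B₁ ∪ B₂)ᶜ) := by
    have h := measureReal_inter_add_sdiff (μ := μ) (s := B₁ ∪ B₂ ∪ Bc) (hm (B₁ ∪ B₂))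
    have e1 : (B₁ ∪ B₂ ∪ Bc) ∩ (B₁ ∪ B₂) = B₁ ∪ B₂ := Set.inter_eq_right.2 Set.subset_union_left
    have e2 : (B₁ ∪ B₂ ∪ Bc) \ (B₁ ∪ B₂) = Bc ∩ (B₁ ∪ B₂)ᶜ := by
      ext ω
      simp only [Set.mem_sdiff, Set.mem_inter_iff, Set.mem_union, Set.mem_compl_iff]
      tauto
    rw [e1, e2] at h
    have h' := measureReal_inter_add_sdiff (μ := μ) (s := Bc ∩ (B₁ ∪ B₂)ᶜ) (hm (O₁ ∪ O₂ ∪ Oc))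
    have e3 : Bc ∩ (B₁ ∪ B₂)ᶜ ∩ (O₁ ∪ O₂ ∪ Oc) = (O₁ ∪ O₂ ∪ Oc) ∩ Bc ∩ (B₁ ∪ B₂)ᶜ := by
      ext ω; simp only [Set.mem_inter_iff]; tauto
    have e4 : (Bc ∩ (B₁ ∪ B₂)ᶜ) \ (O₁ ∪ O₂ ∪ Oc) = (O₁ ∪ O₂ ∪ Oc)ᶜ ∩ Bc ∩ (B₁ ∪ B₂)ᶜ := by
      ext ω; simp only [Set.mem_sdiff, Set.mem_inter_iff, Set.mem_compl_iff]; tauto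
    rw [e3, e4] at h'
    linarith
  -- (d3) `μ(TaW) = μ(Ab) − τ_c − G_c − ROOM₁`
  have hd3 : μ.real ((O₁ ∪ O₂ ∪ Oc) ∩ (B₁ ∪ B₂) ∩ Bcᶜ ∩ (C₁ᶜ ∩ C₂ᶜ)) =
      μ.real (B₁ ∪ B₂ ∪ Bc) - μ.real Bc - μ.real (Bcᶜ ∩ (C₁ ∪ C₂) ∩ (B₁ ∪ B₂)) -
        μ.real ((O₁ ∪ O₂ ∪ Oc)ᶜ ∩ (B₁ ∪ B₂) ∩ Bcᶜ ∩ (C₁ᶜ ∩ C₂ᶜ)) := by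
    have h := measureReal_inter_add_sdiff (μ := μ) (s := B₁ ∪ B₂ ∪ Bc) (hm Bc)
    have e1 : (B₁ ∪ B₂ ∪ Bc) ∩ Bc = Bc := Set.inter_eq_right.2 Set.subset_union_right
    have e2 : (B₁ ∪ B₂ ∪ Bc) \ Bc = (B₁ ∪ B₂) ∩ Bcᶜ := by
      ext ω
      simp only [Set.mem_sdiff, Set.mem_inter_iff, Set.mem_union, Set.mem_compl_iff]
      tauto
    rw [e1, e2] at h
    have h' := measureReal_inter_add_sdiff (μ := μ) (s := (B₁ ∪ B₂) ∩ Bcᶜ) (hm (C₁ᶜ ∩ C₂ᶜ))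
    have e4 : ((B₁ ∪ B₂) ∩ Bcᶜ) \ (C₁ᶜ ∩ C₂ᶜ) = Bcᶜ ∩ (C₁ ∪ C₂) ∩ (B₁ ∪ B₂) := by
      ext ω
      simp only [Set.mem_sdiff, Set.mem_inter_iff, Set.mem_union, Set.mem_compl_iff]
      tauto
    rw [e4] at h'
    have h'' := measureReal_inter_add_sdiff (μ := μ) (s := (B₁ ∪ B₂) ∩ Bcᶜ ∩ (C₁ᶜ ∩ C₂ᶜ)) (hm (O₁ ∪ O₂ ∪ Oc))
    have e5 : (B₁ ∪ B₂) ∩ Bcᶜ ∩ (C₁ᶜ ∩ C₂ᶜ) ∩ (O₁ ∪ O₂ ∪ Oc) =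
        (O₁ ∪ O₂ ∪ Oc) ∩ (B₁ ∪ B₂) ∩ Bcᶜ ∩ (C₁ᶜ ∩ C₂ᶜ) := by
      ext ω; simp only [Set.mem_inter_iff]; tauto
    have e6 : ((B₁ ∪ B₂) ∩ Bcᶜ ∩ (C₁ᶜ ∩ C₂ᶜ)) \ (O₁ ∪ O₂ ∪ Oc) =
        (O₁ ∪ O₂ ∪ Oc)ᶜ ∩ (B₁ ∪ B₂) ∩ Bcᶜ ∩ (C₁ᶜ ∩ C₂ᶜ) := by
      ext ω; simp only [Set.mem_sdiff, Set.mem_inter_iff, Set.mem_compl_iff]; tauto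
    rw [e5, e6] at h''
    linarith
  -- Step 3: assembly
  have hψ1 : 0 ≤ μ.real (C₁ᶜ ∩ C₂ᶜ ∩ (O₁ ∪ O₂)) := measureReal_nonneg
  have hψ2 : 0 ≤ μ.real (C₁ᶜ ∩ C₂ᶜ ∩ Oc) := measureReal_nonneg
  by_cases hψ : μ.real (C₁ᶜ ∩ C₂ᶜ ∩ (O₁ ∪ O₂)) + μ.real (C₁ᶜ ∩ C₂ᶜ ∩ Oc) = 0
  · -- degenerate case: `μ(GG) = 0` and Kozma–Nitzan Lemma 4
    have hGGsub : (O₁ ∪ O₂ ∪ Oc) ∩ Obᶜ ∩ ((O₁ ∪ O₂) ∩ (B₁ ∪ B₂))ᶜ ∩ (B₁ ∪ B₂ ∪ Bc) ⊆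
        (C₁ᶜ ∩ C₂ᶜ ∩ (O₁ ∪ O₂)) ∪ (C₁ᶜ ∩ C₂ᶜ ∩ Oc) := by
      intro ω hω
      rcases hω with ⟨⟨⟨hO, -⟩, hnX⟩, hB⟩
      simp only [Set.mem_union, Set.mem_inter_iff, Set.mem_compl_iff, not_and, not_or] at hO hB hnX ⊢
      have hnb : (ω ∈ O₁ ∨ ω ∈ O₂) → ω ∉ B₁ ∧ ω ∉ B₂ := fun h => hnX h
      have hN' : ω ∉ C₁ ∧ ω ∉ C₂ := by
        constructor
        · intro hc1
          have hO12 : ω ∈ O₁ ∨ ω ∈ O₂ := by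
            rcases hO with h | hc
            · exact h
            · exact Or.inl (SimpleGraph.Reachable.trans hc hc1)
          have hnb' := hnb hO12
          rcases hB with (hb1 | hb2) | hbc
          · exact hnb'.1 hb1
          · exact hnb'.2 hb2
          · exact hnb'.1 (SimpleGraph.Reachable.trans (SimpleGraph.Reachable.symm hc1) hbc)
        · intro hc2
          have hO12 : ω ∈ O₁ ∨ ω ∈ O₂ := by
            rcases hO with h | hc
            · exact h
            · exact Or.inr (SimpleGraph.Reachable.trans hc hc2)
          have hnb' := hnb hO12
          rcases hB with (hb1 | hb2) | hbc
          · exact hnb'.1 hb1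
          · exact hnb'.2 hb2
          · exact hnb'.2 (SimpleGraph.Reachable.trans (SimpleGraph.Reachable.symm hc2) hbc)
      rcases hO with hO12 | hc
      · exact Or.inl ⟨hN', hO12⟩
      · exact Or.inr ⟨hN', hc⟩
    have hGG0 : μ.real ((O₁ ∪ O₂ ∪ Oc) ∩ Obᶜ ∩ ((O₁ ∪ O₂) ∩ (B₁ ∪ B₂))ᶜ ∩ (B₁ ∪ B₂ ∪ Bc)) = 0 := by
      have h1 := measureReal_mono (μ := μ) hGGsub (measure_ne_top _ _)
      have h2 := measureReal_union_le (μ := μ) (C₁ᶜ ∩ C₂ᶜ ∩ (O₁ ∪ O₂)) (C₁ᶜ ∩ C₂ᶜ ∩ Oc)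
      linarith [measureReal_nonneg (μ := μ)
        (s := (O₁ ∪ O₂ ∪ Oc) ∩ Obᶜ ∩ ((O₁ ∪ O₂) ∩ (B₁ ∪ B₂))ᶜ ∩ (B₁ ∪ B₂ ∪ Bc))]
    have hL4 := knLemma4_pair w o a₁ a₂ b
    simp only [← hμ, ← hO₁, ← hO₂, ← hOb, ← hB₁, ← hB₂] at hL4
    have hmin : θ ≤ min (μ.real B₁) (μ.real B₂) := le_min hθ1 hθ2
    have hmono : μ.real (B₁ ∪ B₂) ≤ μ.real (B₁ ∪ B₂ ∪ Bc) :=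
      measureReal_mono (μ := μ) Set.subset_union_left (measure_ne_top _ _)
    rw [hd1, hGG0]
    linarith
  · have hψpos : 0 < μ.real (C₁ᶜ ∩ C₂ᶜ ∩ (O₁ ∪ O₂)) + μ.real (C₁ᶜ ∩ C₂ᶜ ∩ Oc) :=
      lt_of_le_of_ne (add_nonneg hψ1 hψ2) (Ne.symm hψ)
    rw [hd2, hd3] at hT
    rw [hd1]
    have key : (μ.real (C₁ᶜ ∩ C₂ᶜ ∩ (O₁ ∪ O₂)) + μ.real (C₁ᶜ ∩ C₂ᶜ ∩ Oc)) *
        (μ.real (Obᶜ ∩ (O₁ ∪ O₂) ∩ (B₁ ∪ B₂)) +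
          μ.real ((O₁ ∪ O₂ ∪ Oc) ∩ Obᶜ ∩ ((O₁ ∪ O₂) ∩ (B₁ ∪ B₂))ᶜ ∩ (B₁ ∪ B₂ ∪ Bc)) + θ -
          μ.real (B₁ ∪ B₂ ∪ Bc)) ≤ 0 := by
      nlinarith [hT, hstar]
    have key2 : μ.real (Obᶜ ∩ (O₁ ∪ O₂) ∩ (B₁ ∪ B₂)) +
        μ.real ((O₁ ∪ O₂ ∪ Oc) ∩ Obᶜ ∩ ((O₁ ∪ O₂) ∩ (B₁ ∪ B₂))ᶜ ∩ (B₁ ∪ B₂ ∪ Bc)) + θ -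
        μ.real (B₁ ∪ B₂ ∪ Bc) ≤ 0 := by
      by_contra hc
      have hc' : 0 < μ.real (Obᶜ ∩ (O₁ ∪ O₂) ∩ (B₁ ∪ B₂)) +
          μ.real ((O₁ ∪ O₂ ∪ Oc) ∩ Obᶜ ∩ ((O₁ ∪ O₂) ∩ (B₁ ∪ B₂))ᶜ ∩ (B₁ ∪ B₂ ∪ Bc)) + θ -
          μ.real (B₁ ∪ B₂ ∪ Bc) := lt_of_not_ge hc
      have := mul_pos hψpos hc'
      linarith
    linarith


/-- **CAG(3) from the hypothesis-free form (V3′)** ("Kozma–Nitzan Lemma 4 with a weighted spectator"):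
if `(ψ₁₂ + ψ_c)·G_o ≤ ψ₁₂·(μ(a₁↔b ∪ a₂↔b) − min(τ_{a₁},τ_{a₂}) + ROOM₂) + ψ_c·(G_c + ROOM₁)` and `θ ≤ τ_{a₁}, τ_{a₂}, τ_c`,
then (★★) holds and hence CAG(3) (`twoStep_cag3`).  (V3′) is numerically robust (task memo TWOSTEP-GLUE.md) and OPEN.
[cite: KozmaNitzan2024, Lemma 4 (p. 9), Question 7 (p. 36)] -/
theorem twoStep_cag3_of_v3prime (w : Sym2 (Fin n) → unitInterval) (o b a₁ a₂ c : Fin n) (h12 : a₁ ≠ a₂) (h1c : a₁ ≠ c)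
    (θ : ℝ) (hθ1 : θ ≤ (prodBernoulli w).real (openConn a₁ b)) (hθ2 : θ ≤ (prodBernoulli w).real (openConn a₂ b))
    (hθc : θ ≤ (prodBernoulli w).real (openConn c b))
    (hV :
      ((prodBernoulli w).real ((openConn c a₁)ᶜ ∩ (openConn c a₂)ᶜ ∩ (openConn o a₁ ∪ openConn o a₂)) +
          (prodBernoulli w).real ((openConn c a₁)ᶜ ∩ (openConn c a₂)ᶜ ∩ openConn o c)) *
        (prodBernoulli w).real ((openConn o b)ᶜ ∩ (openConn o a₁ ∪ openConn o a₂) ∩ (openConn a₁ b ∪ openConn a₂ b)) ≤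
      (prodBernoulli w).real ((openConn c a₁)ᶜ ∩ (openConn c a₂)ᶜ ∩ (openConn o a₁ ∪ openConn o a₂)) *
          ((prodBernoulli w).real (openConn a₁ b ∪ openConn a₂ b) -
              min ((prodBernoulli w).real (openConn a₁ b)) ((prodBernoulli w).real (openConn a₂ b)) +
            (prodBernoulli w).real ((openConn o a₁ ∪ openConn o a₂ ∪ openConn o c)ᶜ ∩ openConn c b ∩
              (openConn a₁ b ∪ openConn a₂ b)ᶜ)) +
        (prodBernoulli w).real ((openConn c a₁)ᶜ ∩ (openConn c a₂)ᶜ ∩ openConn o c) *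
          ((prodBernoulli w).real ((openConn c b)ᶜ ∩ (openConn c a₁ ∪ openConn c a₂) ∩ (openConn a₁ b ∪ openConn a₂ b)) +
            (prodBernoulli w).real ((openConn o a₁ ∪ openConn o a₂ ∪ openConn o c)ᶜ ∩ (openConn a₁ b ∪ openConn a₂ b) ∩
              (openConn c b)ᶜ ∩ ((openConn c a₁)ᶜ ∩ (openConn c a₂)ᶜ)))) :
    (prodBernoulli w).real ((openConn o a₁ ∪ openConn o a₂ ∪ openConn o c) ∩ (openConn o b)ᶜ ∩
        (openConn a₁ b ∪ openConn a₂ b ∪ openConn c b)) ≤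
      (prodBernoulli w).real (openConn a₁ b ∪ openConn a₂ b ∪ openConn c b) - θ := by
  apply twoStep_cag3 w o b a₁ a₂ c h12 h1c θ hθ1 hθ2
  have hψ1 : 0 ≤ (prodBernoulli w).real ((openConn c a₁)ᶜ ∩ (openConn c a₂)ᶜ ∩ (openConn o a₁ ∪ openConn o a₂)) :=
    measureReal_nonneg
  have hψ2 : 0 ≤ (prodBernoulli w).real ((openConn c a₁)ᶜ ∩ (openConn c a₂)ᶜ ∩ openConn o c) := measureReal_nonneg
  have hmin : θ ≤ min ((prodBernoulli w).real (openConn a₁ b)) ((prodBernoulli w).real (openConn a₂ b)) := le_min hθ1 hθ2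
  have k1 := mul_le_mul_of_nonneg_left hmin hψ1
  have k2 := mul_le_mul_of_nonneg_left hθc hψ2
  nlinarith [hV, k1, k2]

/-- **The three-relay E-form from (★★) for one pair.**  Relays `a₁, a₂, a₃` with `1 − t ≤ τ_{a_i}` (`i = 1, 2`; the third is
free), `a₁ ≠ a₂`, `a₁ ≠ a₃`; if (★★) holds for the glued pair `{a₁,a₂}` with spectator `a₃` and `θ = 1 − t`, then
`μ((o↔a₁ ∪ o↔a₂ ∪ o↔a₃) ∖ o↔b) ≤ t` — the conclusion of the registered three-relay stubs of the line
(`stub_threeRelaysFullTieAllBad_pl`, `stub_threeRelaysTieEform_c7`) at that instance.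
[cite: KozmaNitzan2024, Question 7 (p. 36), Conjecture 1 (p. 3)] -/
theorem twoStep_threeRelays_eform (w : Sym2 (Fin n) → unitInterval) (o b a₁ a₂ a₃ : Fin n) (t : ℝ)
    (h12 : a₁ ≠ a₂) (h13 : a₁ ≠ a₃)
    (ht1 : 1 - t ≤ (prodBernoulli w).real (openConn a₁ b)) (ht2 : 1 - t ≤ (prodBernoulli w).real (openConn a₂ b))
    (hstar :
      ((prodBernoulli w).real ((openConn a₃ a₁)ᶜ ∩ (openConn a₃ a₂)ᶜ ∩ (openConn o a₁ ∪ openConn o a₂)) +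
          (prodBernoulli w).real ((openConn a₃ a₁)ᶜ ∩ (openConn a₃ a₂)ᶜ ∩ openConn o a₃)) *
        ((prodBernoulli w).real ((openConn o b)ᶜ ∩ (openConn o a₁ ∪ openConn o a₂) ∩ (openConn a₁ b ∪ openConn a₂ b)) +
          (1 - t)) ≤
      (prodBernoulli w).real ((openConn a₃ a₁)ᶜ ∩ (openConn a₃ a₂)ᶜ ∩ (openConn o a₁ ∪ openConn o a₂)) *
          ((prodBernoulli w).real (openConn a₁ b ∪ openConn a₂ b) +
            (prodBernoulli w).real ((openConn o a₁ ∪ openConn o a₂ ∪ openConn o a₃)ᶜ ∩ openConn a₃ b ∩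
              (openConn a₁ b ∪ openConn a₂ b)ᶜ)) +
        (prodBernoulli w).real ((openConn a₃ a₁)ᶜ ∩ (openConn a₃ a₂)ᶜ ∩ openConn o a₃) *
          ((prodBernoulli w).real (openConn a₃ b) +
            (prodBernoulli w).real ((openConn a₃ b)ᶜ ∩ (openConn a₃ a₁ ∪ openConn a₃ a₂) ∩ (openConn a₁ b ∪ openConn a₂ b)) +
            (prodBernoulli w).real ((openConn o a₁ ∪ openConn o a₂ ∪ openConn o a₃)ᶜ ∩ (openConn a₁ b ∪ openConn a₂ b) ∩
              (openConn a₃ b)ᶜ ∩ ((openConn a₃ a₁)ᶜ ∩ (openConn a₃ a₂)ᶜ)))) :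
    (prodBernoulli w).real ((openConn o a₁ ∪ openConn o a₂ ∪ openConn o a₃) \ openConn o b) ≤ t := by
  have hcag := twoStep_cag3 w o b a₁ a₂ a₃ h12 h13 (1 - t) ht1 ht2 hstar
  have hm : ∀ s : Set (BondConfig (Fin n)), MeasurableSet s := fun _ => MeasurableSet.of_discrete
  set μ := prodBernoulli w with hμ
  set oA : Set (BondConfig (Fin n)) := openConn o a₁ ∪ openConn o a₂ ∪ openConn o a₃ with hoA
  set Ab : Set (BondConfig (Fin n)) := openConn a₁ b ∪ openConn a₂ b ∪ openConn a₃ b with hAb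
  have h1 := measureReal_inter_add_sdiff (μ := μ) (s := oA \ openConn o b) (hm Ab)
  have e1 : (oA \ openConn o b) ∩ Ab = oA ∩ (openConn o b)ᶜ ∩ Ab := by
    rw [Set.sdiff_eq]
  have h2 : μ.real ((oA \ openConn o b) \ Ab) ≤ μ.real Abᶜ :=
    measureReal_mono (fun ω hω => hω.2) (measure_ne_top _ _)
  have h3 : μ.real Abᶜ = 1 - μ.real Ab := probReal_compl_eq_one_sub (hm _)
  rw [e1] at h1
  linarith

end

end Summit.CriticalPhenomena.PercolationContinuityZ3.Theorems
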